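import Summits.HodgeConjecture.CorCM.Census.OcticCurveFourfold
import HarnessLib

/-!
# `B × E` (octic CM field `⊇ k`, `k`-signature `(1,3)`), sequel: the generating parts of a balanced configuration —
# conjugate pairs and `k`-Weil `6`-sets of `B × E × E` — extraction and the induction principle for all products of copies

COR-CM (cell `pub-hodgecm2`), seat b30 gen 18 (2026-08-21); count-neutral own lane OCTIC-EB (lit-andre-3's prover-lane ask
A6-R26, generalised).  Sequel of `Census/OcticCurveFourfold.lean` (the 10-point model `Pt = Bool ⊕ (Fin 4 × Bool)`, `cj`,
`phiPre`, `ModelBalanced`, the DEFECT LAW `exists_defect_of_modelBalanced`); two bookkeeping definitions (`IsPairPart`,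
`IsWeilPart`) and theorems; no named fact, no geometry, no `sorry`.

* `IsPairPart v G` — two points over a conjugate pair of labels `{y, cj y}` (a divisor weight, possibly over two copies);
  **`IsWeilPart v b G`** — six points: TWO over the curve label `inl b` (necessarily in two different copies of `E`:
  `IsWeilPart.exists_pair`) and one over each label `inr (a, b)` of `F` of sign `b` (`IsWeilPart.eq_of_inr`) — a lift of
  the weight `2[inl b] + Σ_a [(a,b)]` of the Weil line `⋀⁶ H¹(B × E × E)_b`; both balanced (`….modelBalanced`, by
  `decide` on the count functions `IsPairPart.count_eq` / `IsWeilPart.count_eq`);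
* `exists_part_of_modelBalanced` — EXTRACTION from the defect law: `t > 0` gives a Weil part of sign `true`, `t < 0` of sign
  `false`, `t = 0` a pair part;
* **`modelBalanced_induction`** — a property of configurations holding for `∅` and passing from `R` to `G ∪ R` for disjoint
  pair parts and Weil parts holds for every balanced configuration.  For `B^n × E^a` this is the combinatorial half of
  the Hodge conjecture for all products of copies; the geometric half (pair parts are divisor lines; Weil parts are lines of
  the Weil plane of the sixfold `B × E × E` lifted by seat b30's distribution lemma `CorCM/CMWeightDistribution.lean`) is
  `CorCM/OcticCurveFourfoldWeilSixfold.lean` / `…PowersHodgeOfMarkman.lean`.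
[cite: Pohlmann1968, Thm 1] [cite: GaoUllmo2025, Thm 3.1] [cite: Milne2020HodgeClassesAV, 1.2 (a) and Thm. 1]
[cite: Deligne1982HodgeCycles, §5 (c)] [cite: MoonenZarhin1998WeilClasses, §1]

## References
* [Pohlmann1968] H. Pohlmann, Ann. of Math. 88 (1968), Thm 1.  [GaoUllmo2025] Z. Gao, E. Ullmo, J. Inst. Math. Jussieu
  25 (2025), Thm 3.1.  [Milne2020HodgeClassesAV] J. S. Milne, arXiv:2010.08857, 1.2 (a), Thm. 1 (André: CM Hodge classes
  are sums of pull-backs of Weil classes).  [Deligne1982HodgeCycles] P. Deligne, LNM 900 (1982), §5 (c).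
  [MoonenZarhin1998WeilClasses] B. Moonen, Yu. Zarhin, J. reine angew. Math. 496 (1998), §1.
  [Gordon1999HodgeAVSurvey] B. B. Gordon, CRM Monogr. 10 (1999), 9.2.2.
-/

namespace Summit.HodgeConjecture.CorCM.Census.OcticCurveFourfold

open Finset

variable {α : Type*} {v : α → Pt}

/-! ### The generating parts -/

/-- **A pair part**: two points of `T` over a conjugate pair of labels `{y, cj y}` (a divisor weight, possibly spread over
two copies). [cite: Gordon1999HodgeAVSurvey, 9.2.2] -/
def IsPairPart (v : α → Pt) (G : Finset α) : Prop :=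
  ∃ y : Pt, G.card = 2 ∧ Set.InjOn v ↑G ∧ G.image v = {y, cj y}

/-- **A Weil part of sign `b`**: six points of `T`, TWO over the curve label `inl b` (hence in two different copies of `E`)
and one over each of the four labels `inr (a, b)` of `F` of sign `b` — a lift of the weight
`2[inl b] + Σ_a [(a, b)]` of the Weil line `⋀⁶ H¹(B × E × E)_b`. [cite: Deligne1982HodgeCycles, §5 (c)]
[cite: MoonenZarhin1998WeilClasses, §1] -/
def IsWeilPart (v : α → Pt) (b : Bool) (G : Finset α) : Prop :=
  G.card = 6 ∧ (G.filter fun x => v x = Sum.inl b).card = 2 ∧ ∀ a : Fin 4, (G.filter fun x => v x = Sum.inr (a, b)).card = 1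

/-- The count function of a pair part: `1` on `y` and `cj y`, `0` elsewhere. [folklore] -/
theorem IsPairPart.count_eq [DecidableEq α] {G : Finset α} (hG : IsPairPart v G) : ∃ y : Pt, ∀ z : Pt,
    (G.filter fun x => v x = z).card = if z = y ∨ z = cj y then 1 else 0 := by
  obtain ⟨y, hcard, hinj, himg⟩ := hG
  refine ⟨y, fun z => ?_⟩
  have hfib : ∀ z, (G.filter fun x => v x = z).card = if z ∈ G.image v then 1 else 0 := by
    intro z
    split_ifs with hz
    · obtain ⟨x, hx, rfl⟩ := Finset.mem_image.1 hz
      rw [Finset.card_eq_one]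
      refine ⟨x, Finset.eq_singleton_iff_unique_mem.2 ⟨Finset.mem_filter.2 ⟨hx, rfl⟩, fun x' hx' => ?_⟩⟩
      exact hinj (Finset.mem_of_mem_filter _ hx') hx (Finset.mem_filter.1 hx').2
    · rw [Finset.card_eq_zero, Finset.filter_eq_empty_iff]
      exact fun x hx hxz => hz (hxz ▸ Finset.mem_image_of_mem v hx)
  rw [hfib z, himg]
  simp only [Finset.mem_insert, Finset.mem_singleton]

/-- The count function of a Weil part of sign `b`: `2` on `inl b`, `1` on the four `inr (a, b)`, `0` elsewhere.
[folklore] -/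
theorem IsWeilPart.count_eq {b : Bool} {G : Finset α} (hG : IsWeilPart v b G) :
    (∀ c : Bool, (G.filter fun x => v x = Sum.inl c).card = if c = b then 2 else 0) ∧
      ∀ q : Fin 4 × Bool, (G.filter fun x => v x = Sum.inr q).card = if q.2 = b then 1 else 0 := by
  obtain ⟨hcard, hE, hB⟩ := hG
  have htot := card_eq_sum v G
  rw [sum_pt, hcard] at htot
  have hB0 := hB 0; have hB1 := hB 1; have hB2 := hB 2; have hB3 := hB 3
  cases b
  · rw [hE, hB0, hB1, hB2, hB3] at htot
    refine ⟨fun c => ?_, fun q => ?_⟩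
    · cases c
      · simp [hE]
      · simp only [Bool.true_eq_false, ↓reduceIte]; omega
    · obtain ⟨a, c⟩ := q
      rcases fin4_cases a with rfl | rfl | rfl | rfl <;> cases c <;>
        simp only [Fin.isValue, Bool.true_eq_false, ↓reduceIte, hB0, hB1, hB2, hB3] <;> omega
  · rw [hE, hB0, hB1, hB2, hB3] at htot
    refine ⟨fun c => ?_, fun q => ?_⟩
    · cases c
      · simp only [Bool.false_eq_true, ↓reduceIte]; omega
      · simp [hE]
    · obtain ⟨a, c⟩ := q
      rcases fin4_cases a with rfl | rfl | rfl | rfl <;> cases c <;>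
        simp only [Fin.isValue, Bool.false_eq_true, ↓reduceIte, hB0, hB1, hB2, hB3] <;> omega

/-- **A pair part is balanced.** [cite: Gordon1999HodgeAVSurvey, 9.2.2] -/
theorem IsPairPart.modelBalanced [DecidableEq α] {G : Finset α} (hG : IsPairPart v G) : ModelBalanced v G := by
  obtain ⟨y, hy⟩ := hG.count_eq
  rw [modelBalanced_iff_counts]
  simp only [hy]
  have key : ∀ y : Pt, ∀ p : Fin 4 × Bool, 2 * ∑ z ∈ phiPre p, (if z = y ∨ z = cj y then 1 else 0) =
      ∑ z : Pt, (if z = y ∨ z = cj y then 1 else 0) := by decide +kernel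
  exact key y

/-- **A Weil part is balanced** (the Weil line of the sixfold `B × E × E` is a Hodge class: `k`-signature
`(1,3) + (1,0) + (1,0) = (3,3)`). [cite: Deligne1982HodgeCycles, §5 (c)] [cite: MoonenZarhin1998WeilClasses, §1] -/
theorem IsWeilPart.modelBalanced {b : Bool} {G : Finset α} (hG : IsWeilPart v b G) : ModelBalanced v G := by
  classical
  obtain ⟨hc, hq⟩ := hG.count_eq
  have hN : ∀ z : Pt, (G.filter fun x => v x = z).card =
      Sum.elim (fun c => if c = b then 2 else 0) (fun q : Fin 4 × Bool => if q.2 = b then 1 else 0) z := by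
    rintro (c | q)
    · exact hc c
    · exact hq q
  rw [modelBalanced_iff_counts]
  simp only [hN]
  have key : ∀ b : Bool, ∀ p : Fin 4 × Bool,
      2 * ∑ z ∈ phiPre p, Sum.elim (fun c => if c = b then 2 else 0) (fun q : Fin 4 × Bool => if q.2 = b then 1 else 0) z =
        ∑ z : Pt, Sum.elim (fun c => if c = b then 2 else 0) (fun q : Fin 4 × Bool => if q.2 = b then 1 else 0) z := by
    decide +kernel
  exact key b

/-- A Weil part is non-empty. [folklore] -/
theorem IsWeilPart.nonempty {b : Bool} {G : Finset α} (hG : IsWeilPart v b G) : G.Nonempty := by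
  rw [← Finset.card_pos, hG.1]; norm_num

/-- A pair part is non-empty. [folklore] -/
theorem IsPairPart.nonempty {G : Finset α} (hG : IsPairPart v G) : G.Nonempty := by
  obtain ⟨_, hcard, -⟩ := hG
  rw [← Finset.card_pos, hcard]; norm_num

/-- In a Weil part the two points over the curve label are distinct elements (so lie in two different copies of `E`).
[folklore] -/
theorem IsWeilPart.exists_pair [DecidableEq α] {b : Bool} {G : Finset α} (hG : IsWeilPart v b G) :
    ∃ x₁ ∈ G, ∃ x₂ ∈ G, x₁ ≠ x₂ ∧ v x₁ = Sum.inl b ∧ v x₂ = Sum.inl b := by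
  obtain ⟨x₁, x₂, hne, h12⟩ := Finset.card_eq_two.1 hG.2.1
  have h1 : x₁ ∈ G.filter fun x => v x = Sum.inl b := by rw [h12]; simp
  have h2 : x₂ ∈ G.filter fun x => v x = Sum.inl b := by rw [h12]; simp
  exact ⟨x₁, (Finset.mem_filter.1 h1).1, x₂, (Finset.mem_filter.1 h2).1, hne, (Finset.mem_filter.1 h1).2,
    (Finset.mem_filter.1 h2).2⟩

/-- Every point of a Weil part of sign `b` has sign `b`. [folklore] -/
theorem IsWeilPart.sgn_eq {b : Bool} {G : Finset α} (hG : IsWeilPart v b G) {x : α} (hx : x ∈ G) : sgn (v x) = b := by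
  obtain ⟨hc, hq⟩ := hG.count_eq
  have hpos : 0 < (G.filter fun x' => v x' = v x).card := Finset.card_pos.2 ⟨x, Finset.mem_filter.2 ⟨hx, rfl⟩⟩
  rcases hvx : v x with c | q
  · rw [hvx, hc c] at hpos
    by_contra h
    rw [sgn_inl] at h
    rw [if_neg h] at hpos
    exact lt_irrefl 0 hpos
  · rw [hvx, hq q] at hpos
    by_contra h
    rw [sgn_inr] at h
    rw [if_neg h] at hpos
    exact lt_irrefl 0 hpos

/-- In a Weil part, two points over fourfold labels with the same label coincide (one point over each label of sign `b`).
[folklore] -/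
theorem IsWeilPart.eq_of_inr {b : Bool} {G : Finset α} (hG : IsWeilPart v b G) {x x' : α} (hx : x ∈ G) (hx' : x' ∈ G)
    {q : Fin 4 × Bool} (hq : v x = Sum.inr q) (hq' : v x' = Sum.inr q) : x = x' := by
  have hqb : q.2 = b := by have h := hG.sgn_eq hx; rwa [hq, sgn_inr] at h
  have h1 := hG.2.2 q.1
  rw [Finset.card_eq_one] at h1
  obtain ⟨z, hz⟩ := h1
  have hxz : x ∈ G.filter fun x => v x = Sum.inr (q.1, b) := Finset.mem_filter.2 ⟨hx, by rw [hq, ← hqb]⟩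
  have hx'z : x' ∈ G.filter fun x => v x = Sum.inr (q.1, b) := Finset.mem_filter.2 ⟨hx', by rw [hq', ← hqb]⟩
  rw [hz, Finset.mem_singleton] at hxz hx'z
  rw [hxz, hx'z]

/-! ### Extraction of a generating part -/

/-- A Weil part inside `T` from the counts: two points over `inl b` and one over each `inr (a, b)`. [folklore] -/
theorem exists_weilPart_of_counts [DecidableEq α] {T : Finset α} (b : Bool)
    (hE : 2 ≤ (T.filter fun x => v x = Sum.inl b).card) (hB : ∀ a : Fin 4, 0 < (T.filter fun x => v x = Sum.inr (a, b)).card) :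
    ∃ G ⊆ T, IsWeilPart v b G := by
  -- two points over the curve label
  obtain ⟨P, hPsub, hPcard⟩ := Finset.exists_subset_card_eq hE
  -- one point over each fourfold label of sign `b`
  have hpick : ∀ a : Fin 4, ∃ x ∈ T, v x = Sum.inr (a, b) := fun a => by
    obtain ⟨x, hx⟩ := Finset.card_pos.1 (hB a)
    exact ⟨x, (Finset.mem_filter.1 hx).1, (Finset.mem_filter.1 hx).2⟩
  choose pick hpickT hpickv using hpick
  have hpinj : Function.Injective pick := fun a a' h => by
    have e := hpickv a
    rw [h, hpickv a'] at e
    exact (Prod.mk.inj (Sum.inr_injective e)).1.symm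
  set Q : Finset α := univ.image pick with hQ
  have hQcard : Q.card = 4 := by
    rw [hQ, Finset.card_image_of_injective _ hpinj, Finset.card_univ, Fintype.card_fin]
  have hPv : ∀ x ∈ P, v x = Sum.inl b := fun x hx => (Finset.mem_filter.1 (hPsub hx)).2
  have hPQ : Disjoint P Q := by
    rw [Finset.disjoint_left]
    intro x hxP hxQ
    obtain ⟨a, -, rfl⟩ := Finset.mem_image.1 hxQ
    have h1 := hPv _ hxP
    rw [hpickv a] at h1
    exact Sum.inr_ne_inl h1
  refine ⟨P ∪ Q, Finset.union_subset (fun x hx => (Finset.mem_filter.1 (hPsub hx)).1)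
    (fun x hx => by obtain ⟨a, -, rfl⟩ := Finset.mem_image.1 hx; exact hpickT a), ?_, ?_, fun a => ?_⟩
  · rw [Finset.card_union_of_disjoint hPQ, hPcard, hQcard]
  · have : (P ∪ Q).filter (fun x => v x = Sum.inl b) = P := by
      ext x
      simp only [Finset.mem_filter, Finset.mem_union]
      constructor
      · rintro ⟨hx | hx, hvx⟩
        · exact hx
        · obtain ⟨a, -, rfl⟩ := Finset.mem_image.1 hx
          rw [hpickv a] at hvx
          exact absurd hvx Sum.inr_ne_inl
      · intro hx
        exact ⟨Or.inl hx, hPv x hx⟩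
    rw [this, hPcard]
  · rw [Finset.card_eq_one]
    refine ⟨pick a, ?_⟩
    ext x
    simp only [Finset.mem_filter, Finset.mem_union, Finset.mem_singleton]
    constructor
    · rintro ⟨hx | hx, hvx⟩
      · rw [hPv x hx] at hvx
        exact absurd hvx Sum.inl_ne_inr
      · obtain ⟨a', -, rfl⟩ := Finset.mem_image.1 hx
        rw [hpickv a'] at hvx
        rw [(Prod.mk.inj (Sum.inr_injective hvx)).1]
    · rintro rfl
      exact ⟨Or.inr (Finset.mem_image_of_mem _ (Finset.mem_univ a)), hpickv a⟩

/-- A pair part inside `T` from the counts: one point over `y` and one over `cj y`. [folklore] -/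
theorem exists_pairPart_of_counts [DecidableEq α] {T : Finset α} (y : Pt)
    (hy : 0 < (T.filter fun x => v x = y).card) (hcy : 0 < (T.filter fun x => v x = cj y).card) :
    ∃ G ⊆ T, IsPairPart v G := by
  obtain ⟨x, hx₀⟩ := Finset.card_pos.1 hy
  obtain ⟨hxT, hx⟩ := Finset.mem_filter.1 hx₀
  obtain ⟨x', hx₀'⟩ := Finset.card_pos.1 hcy
  obtain ⟨hx'T, hx'⟩ := Finset.mem_filter.1 hx₀'
  have hne : x ≠ x' := by
    intro h
    apply cj_facts.2.1 y
    rw [← hx', ← h, hx]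
  refine ⟨{x, x'}, ?_, y, Finset.card_pair hne, ?_, ?_⟩
  · intro z hz
    rcases Finset.mem_insert.1 hz with rfl | hz
    · exact hxT
    · rw [Finset.mem_singleton.1 hz]; exact hx'T
  · intro z hz z' hz' hzz'
    simp only [Finset.coe_insert, Finset.coe_singleton, Set.mem_insert_iff, Set.mem_singleton_iff] at hz hz'
    rcases hz with rfl | rfl <;> rcases hz' with rfl | rfl
    · rfl
    · exfalso; rw [hx, hx'] at hzz'; exact cj_facts.2.1 y hzz'.symm
    · exfalso; rw [hx, hx'] at hzz'; exact cj_facts.2.1 y hzz'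
    · rfl
  · rw [Finset.image_insert, Finset.image_singleton, hx, hx']

/-- **EXTRACTION.**  A non-empty balanced configuration contains a pair part or a Weil part: by the defect law, if `t > 0`
then `N(inl true) ≥ 2` and every `N(inr (a, true)) ≥ 1` (a Weil part of sign `true`), if `t < 0` symmetrically (sign
`false`), and if `t = 0` the conjugate of any hit point is hit (a pair part).
[cite: Milne2020HodgeClassesAV, 1.2 (a) and Thm. 1] [cite: Deligne1982HodgeCycles, §5 (c)] -/
theorem exists_part_of_modelBalanced [DecidableEq α] {T : Finset α} (hT : ModelBalanced v T) (hne : T.Nonempty) :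
    ∃ G ⊆ T, IsPairPart v G ∨ ∃ b, IsWeilPart v b G := by
  obtain ⟨t, hEt, hBt⟩ := exists_defect_of_modelBalanced hT
  by_cases ht : 0 < t
  · obtain ⟨G, hG, hW⟩ := exists_weilPart_of_counts (v := v) (T := T) true (by omega) fun a => by
      have h := hBt a; omega
    exact ⟨G, hG, Or.inr ⟨true, hW⟩⟩
  by_cases ht' : t < 0
  · obtain ⟨G, hG, hW⟩ := exists_weilPart_of_counts (v := v) (T := T) false (by omega) fun a => by
      have h := hBt a; omega
    exact ⟨G, hG, Or.inr ⟨false, hW⟩⟩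
  have ht0 : t = 0 := by omega
  subst ht0
  obtain ⟨x, hx⟩ := hne
  have hNx : 0 < (T.filter fun x' => v x' = v x).card := Finset.card_pos.2 ⟨x, Finset.mem_filter.2 ⟨hx, rfl⟩⟩
  have hNcx : 0 < (T.filter fun x' => v x' = cj (v x)).card := by
    rcases hvx : v x with c | ⟨a, c⟩ <;> rw [hvx] at hNx
    · cases c
      · rw [cj_inl, Bool.not_false]; omega
      · rw [cj_inl, Bool.not_true]; omega
    · have h := hBt a
      cases c
      · rw [cj_inr, Bool.not_false]; omega
      · rw [cj_inr, Bool.not_true]; omega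
  obtain ⟨G, hG, hP⟩ := exists_pairPart_of_counts (v x) hNx hNcx
  exact ⟨G, hG, Or.inl hP⟩

/-! ### The induction principle -/

/-- **INDUCTION PRINCIPLE FOR BALANCED CONFIGURATIONS (any number of copies of `B` and `E`).**  Let `motive` hold for the
empty configuration and pass from `R` to `G ∪ R` whenever `G` is disjoint from `R` and is a pair part or a Weil part.  Then
`motive` holds for every balanced configuration: a non-empty balanced `T` is `G ⊔ (T ∖ G)` with `G` a generating part,
and `T ∖ G` is balanced and smaller. [cite: Milne2020HodgeClassesAV, 1.2 (a) and Thm. 1] [cite: GaoUllmo2025, Thm 3.1] -/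
theorem modelBalanced_induction [DecidableEq α] {motive : Finset α → Prop} (h0 : motive ∅)
    (hpair : ∀ G R : Finset α, Disjoint G R → IsPairPart v G → motive R → motive (G ∪ R))
    (hweil : ∀ (G R : Finset α) (b : Bool), Disjoint G R → IsWeilPart v b G → motive R → motive (G ∪ R))
    {T : Finset α} (hT : ModelBalanced v T) : motive T := by
  induction T using Finset.strongInduction with
  | H T ih =>
    by_cases hTe : T = ∅
    · subst hTe; exact h0
    obtain ⟨G, hGT, hG⟩ := exists_part_of_modelBalanced hT (Finset.nonempty_iff_ne_empty.2 hTe)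
    rcases hG with hP | ⟨b, hW⟩
    · have hR : ModelBalanced v (T \ G) := hT.sdiff hP.modelBalanced hGT
      have hlt : T \ G ⊂ T := Finset.sdiff_ssubset hGT hP.nonempty
      have h := hpair G (T \ G) Finset.disjoint_sdiff hP (ih _ hlt hR)
      rwa [Finset.union_sdiff_of_subset hGT] at h
    · have hR : ModelBalanced v (T \ G) := hT.sdiff hW.modelBalanced hGT
      have hlt : T \ G ⊂ T := Finset.sdiff_ssubset hGT hW.nonempty
      have h := hweil G (T \ G) b Finset.disjoint_sdiff hW (ih _ hlt hR)
      rwa [Finset.union_sdiff_of_subset hGT] at h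

end Summit.HodgeConjecture.CorCM.Census.OcticCurveFourfold
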